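import Summits.CriticalPhenomena.PercolationContinuityZ3.Theorems.SahiMasterFamilyStarAbsorption

/-!
# The SIDE IDENTITY of the block expansion and conjecture (B) for every HALF-ROOTABLE pair of union-closed families, every order

Unit `prim-masterthm-p4` (gen 26; crux anchor stmt-CriticalPhenomena-4575, helper work; memo
`run/shared/lean/prim/prim-masterthm/prim-masterthm-p4/P4-GEN26-REPORT.md` §1–§3).  Companion of `…StarAbsorption` (the edge polynomial of
`(𝒢, 𝒱)` is `BPos` whenever `𝒢 ⊇ star z` and `𝒱` is union-closed) and `…UCBernsteinRootable` (gen 22: conjecture (B) for ROOTABLE pairs).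

SETTING.  `T = Fin (n+1)`, families `𝒰, 𝒱` of subsets of `T`, edge polynomial `P_T(w) = Φ_{n+1}(w·1_𝒰 + (1−w)·1_𝒱)`; conjecture (B) =
`BPos (n+1) P_T`; the block expansion at a root `z` (`…BernsteinPos`, gen 22's `(★z)`):
`P_T = W^{(z)} − [T ∉ …] + Σ_{B ∋ z, B ≠ T} (|B|−1)!·γ_B·P_{T∖B}`, `γ_B = w[B∉𝒰] + (1−w)[B∉𝒱]`.

**THE SIDE IDENTITY (`phiSet_mix_eq_star_add`, every real `w`, any families).**  Expanding both `(𝒰,𝒱)` and `(𝒰 ∪ star z, 𝒱)` at `z` (same cap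
term, same complementary factors) and subtracting:
  `P_T(𝒰,𝒱) = P_T(𝒰 ∪ star z, 𝒱) + Σ_{B ∋ z, B ∉ 𝒰} (|B|−1)!·w·(−κ_B)`,  `−κ_B = P_{T∖B}(𝒰|,𝒱|)` (`B ≠ T`), `−κ_T = −1`.
So the cap term absorbs ALL the `(1−w)`-weighted block terms (blocks outside `𝒱`) into the Bernstein-positive quantity `P_T(𝒰 ∪ star z, 𝒱)`
(STAR ABSORPTION), and only the blocks outside `𝒰`, weighted by `w`, remain.  (Paper form, memo §1: `P_T = Σ_{X∋z} P_X(2^X,𝒱)·a_𝒰(T∖X) +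
Σ_{D∋z, D∉𝒰} (|D|−1)!·w·P_{T∖D}`, from `P = a_𝒰 ∗ P(2^·,𝒱)` in the subset-convolution algebra.)

**THE STEP (`bpos_step_sideU` / `bpos_step_sideV`).**  `T ∈ 𝒰`, `𝒱` union-closed, ANY root `z`: if the restricted edge polynomial is `BPos` along
every block `B ∋ z`, `B ≠ T`, `B ∉ 𝒰`, then `P_T` is `BPos (n+1)`.  Compared with gen 22's steps: at a two-sided top only the blocks outside ONE
chosen family must be controlled (not those outside `𝒰 ∩ 𝒱`), and at a one-sided top `T ∈ 𝒰 ∖ 𝒱` the root is FREE (gen 22 needed a root in no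
member of `𝒱`).

**HALF-ROOTABLE pairs (`HalfRootable`, inductive)**: (`vanish`) `T` in neither family and no complementary decomposition; or (`sideU`) `T ∈ 𝒰` and
for some `z` every block `B ∋ z`, `B ≠ T`, `B ∉ 𝒰` has a half-rootable restriction; or (`sideV`) the mirror.  `halfRootable_of_rootable`: every
rootable pair is half-rootable.  **THEOREM (`bpos_phiSet_mix_of_halfRootable`, every order):** a half-rootable pair of union-closed families has a
Bernstein-positive edge polynomial.  REACH (memo §3, exact enumeration, code-g26/halfroot.py): 373 245 of the 374 715 ordered (1,1) orbit-pairs on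
4 points (99.61 %; rootable: 99.53 %) and 34 283 of the 34 485 (1,0) pairs (99.41 %; rootable 94.1 %).  The residue is the crossing designs, where
the typed SIDE CRITERION of the memo (§4: `P_T ≥_B Σ_{B∋z, B∉𝒰, T∖B ∈ 𝒰∪𝒱} (|B|−1)!·w·P_{T∖B}` at a root `z` in a smallest member of `𝒰`;
0 failures on 4 points exhaustively and in all samples to 7 points) takes over.
HONEST FRAMING: an identity, a structural class theorem, every order; conjecture (B) in general, `UCHullNonneg k` (k ≥ 8), Sahi's `C_k` and
the master theorem remain OPEN.  Axioms standard. [this work]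
-/

noncomputable section

open scoped Classical

namespace Summit.CriticalPhenomena.PercolationContinuityZ3.Theorems

namespace SideExpansion

open Finset Function Equiv
open Literature.Combinatorics.Sahi2008
open Literature.Combinatorics.Sahi2008.CycleForm
open PrincipalCapBeta (phiSet realF realW)
open BernsteinPos UCBernsteinNested UCBernsteinRootable StarAbsorption

variable {n : ℕ}

/-! ### The star of a point -/

/-- The star of `z`: all subsets of the ground set containing `z`. [this work] -/
def star (z : Fin (n + 1)) : Finset (Finset (Fin (n + 1))) := univ.filter fun S => z ∈ S

/-- Membership in the star. [this work] -/
theorem mem_star {z : Fin (n + 1)} {S : Finset (Fin (n + 1))} : S ∈ star z ↔ z ∈ S := by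
  unfold star; rw [mem_filter]; exact ⟨fun h => h.2, fun h => ⟨mem_univ _, h⟩⟩

/-- `𝒰 ∪ star z` contains the star of `z`. [this work] -/
theorem star_subset_union (𝒰 : Finset (Finset (Fin (n + 1)))) (z : Fin (n + 1)) :
    ∀ S : Finset (Fin (n + 1)), z ∈ S → S ∈ 𝒰 ∪ star z :=
  fun _ hS => mem_union_right _ (mem_star.2 hS)

/-! ### The side identity at the last index -/

/-- **Side identity** (every real `w`, any two families): expanding `(𝒰,𝒱)` and `(𝒰 ∪ star last, 𝒱)` along the last index and subtracting,
`Φ(mix 𝒰 𝒱 w) = Φ(mix (𝒰 ∪ star last) 𝒱 w) + Σ_{B ∋ last} (|B|−1)!·([B ∉ 𝒰]·w)·(−κ_B)`. [this work] -/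
theorem phiSet_mix_eq_star_add (𝒰 𝒱 : Finset (Finset (Fin (n + 1)))) (w : ℝ) :
    phiSet (n + 1) (mix 𝒰 𝒱 w) = phiSet (n + 1) (mix (𝒰 ∪ star (Fin.last n)) 𝒱 w) +
      ∑ B ∈ univ.filter (fun B : Finset (Fin (n + 1)) => Fin.last n ∈ B),
        ((B.card - 1).factorial : ℝ) * (((if B ∈ 𝒰 then (0 : ℝ) else w)) * (-coRest (realW (mix 𝒰 𝒱 w)) realF B)) := by
  set 𝒰' := 𝒰 ∪ star (Fin.last n) with hU'
  have hoff : ∀ X : Finset (Fin (n + 1)), Fin.last n ∉ X → mix 𝒰' 𝒱 w X = mix 𝒰 𝒱 w X := by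
    intro X hX
    have hXU : X ∈ 𝒰' ↔ X ∈ 𝒰 := by
      rw [hU', mem_union, mem_star]
      exact ⟨fun h => h.elim id fun h' => absurd h' hX, fun h => Or.inl h⟩
    unfold mix
    by_cases hXG : X ∈ 𝒰
    · rw [if_pos (hXU.2 hXG), if_pos hXG]
    · rw [if_neg (fun h => hXG (hXU.1 h)), if_neg hXG]
  rw [phiSet_eq_sum_blocks_last (mix 𝒰 𝒱 w), phiSet_eq_sum_blocks_last (mix 𝒰' 𝒱 w), ← sum_add_distrib]
  refine sum_congr rfl fun B hB => ?_
  have hlB : Fin.last n ∈ B := (mem_filter.1 hB).2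
  rw [coRest_congr_off_last hoff hlB]
  have hBU' : B ∈ 𝒰' := mem_union_right _ (mem_star.2 hlB)
  have e1 : mix 𝒰' 𝒱 w B = mix 𝒰 𝒱 w B + (if B ∈ 𝒰 then (0 : ℝ) else w) := by
    unfold mix
    rw [if_pos hBU']
    by_cases hBU : B ∈ 𝒰
    · rw [if_pos hBU, if_pos hBU]; ring
    · rw [if_neg hBU, if_neg hBU]; ring
  rw [e1]
  ring

/-! ### The side steps -/

/-- **Step `sideU`.**  `univ ∈ 𝒰`, `𝒱` union-closed, ANY root `z`; the restricted edge polynomials along the blocks `B ∋ z`, `B ≠ univ`, `B ∉ 𝒰`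
are Bernstein-positive one order down ⇒ the edge polynomial is `BPos (n+1)`.  (The blocks outside `𝒱` are absorbed by the cap term:
`…StarAbsorption`.) [this work] -/
theorem bpos_step_sideU (𝒰 𝒱 : Finset (Finset (Fin (n + 1)))) (z : Fin (n + 1)) (hU : univ ∈ 𝒰)
    (hVC : ∀ A ∈ 𝒱, ∀ B ∈ 𝒱, A ∪ B ∈ 𝒱)
    (hrestr : ∀ B : Finset (Fin (n + 1)), z ∈ B → B ≠ univ → B ∉ 𝒰 →
      ∀ (m : ℕ) (e : Fin (m + 1) ↪ Fin (n + 1)), (univ : Finset (Fin (m + 1))).map e = univ \ B →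
        BPos (m + 1) (fun w => phiSet (m + 1) (mix (comap e 𝒰) (comap e 𝒱) w))) :
    BPos (n + 1) (fun w => phiSet (n + 1) (mix 𝒰 𝒱 w)) := by
  let σ : Perm (Fin (n + 1)) := Equiv.swap z (Fin.last n)
  set 𝒰' := comap σ.toEmbedding 𝒰 with hU'
  set 𝒱' := comap σ.toEmbedding 𝒱 with hV'
  have hσ : σ (Fin.last n) = z := Equiv.swap_apply_right _ _
  have htopU' : univ ∈ 𝒰' := by rw [hU', mem_comap, Finset.map_univ_equiv]; exact hU
  have hVC' : ∀ A ∈ 𝒱', ∀ B ∈ 𝒱', A ∪ B ∈ 𝒱' := comap_unionClosed _ 𝒱 hVC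
  -- block terms of the relabelled pair
  have hsub : ∀ B' : Finset (Fin (n + 1)), Fin.last n ∈ B' → B' ≠ univ → B' ∉ 𝒰' →
      BPos n (fun w => -coRest (realW (mix 𝒰' 𝒱' w)) realF B') := by
    intro B' hB' hBu' hBU'
    obtain ⟨m, e, he, hsurj, hc⟩ := exists_emb_coRest' hBu'
    have hm : m < n := PhiVertex.lt_of_emb_ne_last e fun j hj => he j (by rw [hj]; exact hB')
    have hrange := map_univ_eq_sdiff e he hsurj
    have hzB : z ∈ B'.map σ.toEmbedding := mem_map.2 ⟨Fin.last n, hB', hσ⟩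
    have hBu : B'.map σ.toEmbedding ≠ univ := by
      intro h
      apply hBu'
      have := congrArg Finset.card h
      rw [card_map, card_univ] at this
      exact eq_univ_of_card _ this
    have hBU : B'.map σ.toEmbedding ∉ 𝒰 := fun h => hBU' ((mem_comap _ 𝒰 B').2 h)
    have key := hrestr (B'.map σ.toEmbedding) hzB hBu hBU m (e.trans σ.toEmbedding) (map_univ_trans_perm e σ B' hrange)
    refine (key.mono (by omega)).congr fun w => ?_
    rw [hc, mix_map, hU', hV', comap_comap, comap_comap, neg_neg]
  have hstar : BPos (n + 1) (fun w => phiSet (n + 1) (mix (𝒰' ∪ star (Fin.last n)) 𝒱' w)) :=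
    bpos_phiSet_mix_of_star n _ 𝒱' (Fin.last n) hVC' (star_subset_union 𝒰' (Fin.last n))
  have hterms : BPos (n + 1) (fun w => ∑ B ∈ univ.filter (fun B : Finset (Fin (n + 1)) => Fin.last n ∈ B),
      ((B.card - 1).factorial : ℝ) * ((if B ∈ 𝒰' then (0 : ℝ) else w) * (-coRest (realW (mix 𝒰' 𝒱' w)) realF B))) := by
    refine BPos.sum _ (fun B w => ((B.card - 1).factorial : ℝ) *
      ((if B ∈ 𝒰' then (0 : ℝ) else w) * (-coRest (realW (mix 𝒰' 𝒱' w)) realF B))) fun B hB => ?_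
    have hlB : Fin.last n ∈ B := (mem_filter.1 hB).2
    by_cases hBU : B ∈ 𝒰'
    · exact bpos_zero.congr fun w => by rw [if_pos hBU]; ring
    · have hBu : B ≠ univ := by rintro rfl; exact hBU htopU'
      exact (((bpos_id.mul (hsub B hlB hBu hBU)).mono (by omega)).smul (Nat.cast_nonneg _)).congr
        fun w => by rw [if_neg hBU]
  have h := (hstar.add hterms).congr fun w => (phiSet_mix_eq_star_add 𝒰' 𝒱' w).symm
  exact h.congr fun w => phiSet_mix_comap_perm σ 𝒰 𝒱 w

/-- **Step `sideV`** (mirror): `univ ∈ 𝒱`, `𝒰` union-closed, any root `z`, the restrictions along the blocks `B ∋ z`, `B ≠ univ`, `B ∉ 𝒱`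
are Bernstein-positive ⇒ the edge polynomial is `BPos (n+1)`. [this work] -/
theorem bpos_step_sideV (𝒰 𝒱 : Finset (Finset (Fin (n + 1)))) (z : Fin (n + 1)) (hV : univ ∈ 𝒱)
    (hUC : ∀ A ∈ 𝒰, ∀ B ∈ 𝒰, A ∪ B ∈ 𝒰)
    (hrestr : ∀ B : Finset (Fin (n + 1)), z ∈ B → B ≠ univ → B ∉ 𝒱 →
      ∀ (m : ℕ) (e : Fin (m + 1) ↪ Fin (n + 1)), (univ : Finset (Fin (m + 1))).map e = univ \ B →
        BPos (m + 1) (fun w => phiSet (m + 1) (mix (comap e 𝒰) (comap e 𝒱) w))) :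
    BPos (n + 1) (fun w => phiSet (n + 1) (mix 𝒰 𝒱 w)) := by
  have hmirror := bpos_step_sideU 𝒱 𝒰 z hV hUC fun B hzB hBu hBV m e he =>
    ((hrestr B hzB hBu hBV m e he).reflect).congr fun w => by rw [mix_swap]
  exact hmirror.reflect.congr fun w => by rw [mix_swap]

/-! ### Half-rootable pairs -/

/-- **Half-rootable pairs** (recursive root-and-side choice; module docstring). [this work] -/
inductive HalfRootable : (n : ℕ) → Finset (Finset (Fin (n + 1))) → Finset (Finset (Fin (n + 1))) → Prop
  | vanish {n : ℕ} {𝒰 𝒱 : Finset (Finset (Fin (n + 1)))} (hU : univ ∉ 𝒰) (hV : univ ∉ 𝒱)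
      (hno : ∀ A ∈ 𝒰, ∀ B ∈ 𝒱, Disjoint A B → A ∪ B ≠ univ) : HalfRootable n 𝒰 𝒱
  | sideU {n : ℕ} {𝒰 𝒱 : Finset (Finset (Fin (n + 1)))} (z : Fin (n + 1)) (hU : univ ∈ 𝒰)
      (h : ∀ B : Finset (Fin (n + 1)), z ∈ B → B ≠ univ → B ∉ 𝒰 →
        ∀ (m : ℕ) (e : Fin (m + 1) ↪ Fin (n + 1)), (univ : Finset (Fin (m + 1))).map e = univ \ B →
          HalfRootable m (comap e 𝒰) (comap e 𝒱)) : HalfRootable n 𝒰 𝒱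
  | sideV {n : ℕ} {𝒰 𝒱 : Finset (Finset (Fin (n + 1)))} (z : Fin (n + 1)) (hV : univ ∈ 𝒱)
      (h : ∀ B : Finset (Fin (n + 1)), z ∈ B → B ≠ univ → B ∉ 𝒱 →
        ∀ (m : ℕ) (e : Fin (m + 1) ↪ Fin (n + 1)), (univ : Finset (Fin (m + 1))).map e = univ \ B →
          HalfRootable m (comap e 𝒰) (comap e 𝒱)) : HalfRootable n 𝒰 𝒱

/-- **THEOREM ((B) for half-rootable pairs, every order).**  A half-rootable pair of union-closed families has a Bernstein-positive edge
polynomial: all degree-`(n+1)` Bernstein coefficients of `w ↦ Φ_{n+1}(w·1_𝒰 + (1−w)·1_𝒱)` are nonnegative. [this work] -/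
theorem bpos_phiSet_mix_of_halfRootable {n : ℕ} {𝒰 𝒱 : Finset (Finset (Fin (n + 1)))} (hr : HalfRootable n 𝒰 𝒱) :
    (∀ A ∈ 𝒰, ∀ B ∈ 𝒰, A ∪ B ∈ 𝒰) → (∀ A ∈ 𝒱, ∀ B ∈ 𝒱, A ∪ B ∈ 𝒱) →
      BPos (n + 1) (fun w => phiSet (n + 1) (mix 𝒰 𝒱 w)) := by
  induction hr with
  | vanish hU hV hno =>
    intro hUC hVC
    exact bpos_zero.congr fun w => (phiSet_mix_eq_zero_of_noDecomp _ _ _ hUC hVC hU hV hno w).symm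
  | sideU z hU h ih =>
    intro hUC hVC
    exact bpos_step_sideU _ _ z hU hVC fun B hzB hBu hBU m e he =>
      ih B hzB hBu hBU m e he (comap_unionClosed e _ hUC) (comap_unionClosed e _ hVC)
  | sideV z hV h ih =>
    intro hUC hVC
    exact bpos_step_sideV _ _ z hV hUC fun B hzB hBu hBV m e he =>
      ih B hzB hBu hBV m e he (comap_unionClosed e _ hUC) (comap_unionClosed e _ hVC)

/-- Pointwise: `(UC-hull)` on every half-rootable edge, every order. [this work] -/
theorem phiSet_mix_nonneg_of_halfRootable {𝒰 𝒱 : Finset (Finset (Fin (n + 1)))} (hr : HalfRootable n 𝒰 𝒱)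
    (hU : ∀ A ∈ 𝒰, ∀ B ∈ 𝒰, A ∪ B ∈ 𝒰) (hV : ∀ A ∈ 𝒱, ∀ B ∈ 𝒱, A ∪ B ∈ 𝒱) {w : ℝ} (hw0 : 0 ≤ w) (hw1 : w ≤ 1) :
    0 ≤ phiSet (n + 1) (mix 𝒰 𝒱 w) :=
  (bpos_phiSet_mix_of_halfRootable hr hU hV).nonneg hw0 hw1

/-- **Every rootable pair is half-rootable** (so the theorem extends `UCBernsteinRootable.bpos_phiSet_mix_of_rootable`). [this work] -/
theorem halfRootable_of_rootable {n : ℕ} {𝒰 𝒱 : Finset (Finset (Fin (n + 1)))} (hr : Rootable n 𝒰 𝒱) :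
    HalfRootable n 𝒰 𝒱 := by
  induction hr with
  | vanish hU hV hno => exact HalfRootable.vanish hU hV hno
  | both z hU hV h ih =>
    exact HalfRootable.sideU z hU fun B hzB hBu hBU m e he => ih B hzB hBu (fun hW => hBU hW.1) m e he
  | right z hU hV hz h ih =>
    exact HalfRootable.sideV z hV fun B hzB _ hBV m e he => ih B hzB hBV m e he
  | left z hU hV hz h ih =>
    exact HalfRootable.sideU z hU fun B hzB _ hBU m e he => ih B hzB hBU m e he

end SideExpansion

end Summit.CriticalPhenomena.PercolationContinuityZ3.Theorems
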